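import Mathlib
import Summits.MatrixMultiplication.Statement
import Summits.MatrixMultiplication.MatrixMultiplication.Theorems.GraphEquationsLowestFormNec
import Summits.MatrixMultiplication.MatrixMultiplication.Theorems.GraphEquationsMaskingWitness

/-!
# Unmasking cost: THEOREM D relative to an elimination flag (`GraphEquations`, M32)

Decomp-mm node «GraphEquations» (lens 5 «finite range + asymptotic regime + bridge», g37); attacked
leaf `MultiplicityReduction` (stmt-MatrixMultiplication-27806).  Target of the node, VERBATIM:
`_root_.MatrixMultiplication`.  Route-neutral (`closes` unchanged); imports no `Theses/` file.

Kernel M28 proved THEOREM D: a family lying cost-free over a nonscalar sequence of length `N`, whose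
LOWEST weighted forms (after a free shift) are pure `P_o(f)` with `rank ∇P(γ) = n²`, gives
`bR(⟨n,n,n⟩) ≤ 2N`; M30/M26 showed that ORDER and MULTIPLICITY are free in this border currency, and
M31 exhibited the one obstruction left: MASKING (the correct family `(f₀₀, f₀₁, f₁₀, f₁₁² − a₀₀f₀₀)` is
nowhere lowest-form nondegenerate, but ONE elimination product `a₀₀·f₀₀` unmasks it).

This file makes «masking cost» a quantity of record (critic g36 a3) and proves the BRIDGE of the
lens in border currency:
* `LowFormsNondeg p` — THEOREM D's hypotheses on a family `p`, packaged;
  `lowFormsNondeg_generator_pow` — pure power families `(f_q^{k_q})_q`, `k_q ≥ 1`, satisfy them.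
* `EqSystem.UnmaskableAt E U x` — however the tests of `E` were computed (any nonscalar sequence
  `gs` carrying them cost-free), at most `U` FURTHER nonscalar multiplications reach a family,
  cost-free over the extended sequence, which after the shift `θ_x` is lowest-form nondegenerate.
* **THEOREM D′** `algBorderRank_le_of_unmaskableAt : bR(⟨n,n,n⟩) ≤ 2·(cost E + U)` — the bridge
  multiplier is `1 + U/cost`, LINEAR in the unmasking budget (contrast `2·3^{m−1}` of the exact
  multiplicity bridge M23/M25).
* Calibration: `unmaskableAt_zero_of_lowInitNondegAt` (`U = 0` for lowest-form nondegenerate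
  systems); `generatorSystem_unmaskableAt_zero` (BCS (15.1) generator systems — in particular
  Strassen's seven products at `n = 2` [Strassen1969]: the cheapest correct system for `W_2`
  (census I68) is PURE, `U = 0`: Q3's first instance, critic g36 a2);
  `unmaskableAt_one_of_tests_eq_maskedFamily` (M31's masked family: `U ≤ 1`, one product `a₀₀·f₀₀`
  and one free sum, `maskedTest_add_unmask`), while M31 shows its tests are nowhere nondegenerate.
* INVERSION `not_unmaskableAt_of_lt`: a correct system with `2(cost + U) < bR(⟨n,n,n⟩)` admits no
  unmasking with `U` products at any base point — cheap equations, if they exist, are DEEPLY masked.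
* The dial `EqAdmissibleUnmask β` / `UnmaskReduction` with `omega_le_of_eqAdmissibleUnmask`,
  `nec_unmaskReduction`, `unmaskReduction_iff_multiplicityReduction` (through `ω`, like M12/M29 —
  a COSTUME-through-ω equivalence, recorded so that nobody re-cuts the route on it) and
  `matrixMultiplication_iff_quadratic_unmaskReduction : ω = 2 ↔ V ∧ UnmaskReduction`.
No `sorry`.  Sources: [BurgisserClausenShokrollahi1997, §4.1, (14.8), (15.1), Problem 16.3],
[Strassen1969], [Blaser2013_thm66] (Bini).
-/

set_option linter.dupNamespace false

noncomputable section

open scoped BigOperators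

namespace Summit.MatrixMultiplication.MatrixMultiplication.Theorems.GraphEquations

open MvPolynomial
open Literature.Computability.AlgebraicComplexity
open Literature.Computability.AlgebraicComplexity.ArithCircuit

variable {n : ℕ}

/-! ## THEOREM D's hypotheses on a family, packaged -/

/-- `LowFormsNondeg p`: orders `m_o` below the support weights, pure weighted components
`p_o,(m_o) = P_o(f)`, and `rank ∇P(γ) = n²` for some `γ` (the hypotheses of THEOREM D, M28). -/
def LowFormsNondeg {T : ℕ} (p : Fin T → MvPolynomial (GraphVars n) ℂ) : Prop :=
  ∃ (m : Fin T → ℕ) (P : Fin T → MvPolynomial (Fin n × Fin n) ℂ) (γ : Fin n × Fin n → ℂ),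
    (∀ o, ∀ μ ∈ (p o).support, m o ≤ Finsupp.weight (gw n) μ) ∧
    (∀ o, weightedHomogeneousComponent (gw n) (m o) (p o) = aeval (generator n) (P o)) ∧
    (gradMatrix γ P).rank = n * n

/-- THEOREM D (M28) in packaged form. -/
theorem algBorderRank_le_of_lowFormsNondeg {T N : ℕ} {p : Fin T → MvPolynomial (GraphVars n) ℂ}
    (hspan : ∃ gs : List (MvPolynomial (GraphVars n) ℂ), IsNonscalarSeq gs ∧ gs.length ≤ N ∧
      ∀ o, p o ∈ freeSpan {x | x ∈ gs})
    (h : LowFormsNondeg p) : algBorderRank (matMulTensor ℂ n n n) ≤ 2 * N := by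
  obtain ⟨m, P, γ, hlow, hinit, hrank⟩ := h
  exact algBorderRank_le_of_lowestForms p hspan m hlow P hinit γ hrank

/-- **Pure power families are lowest-form nondegenerate**: `(f_{e(o)}^{k_{e(o)}})_o` with all
`k_q ≥ 1` (orders `2k`, forms `F^k`, `γ ≡ 1`, gradient `diag(k)` reindexed). -/
theorem lowFormsNondeg_generator_pow {T : ℕ} (e : Fin T ≃ Fin n × Fin n) (k : Fin n × Fin n → ℕ)
    (hk : ∀ q, k q ≠ 0) : LowFormsNondeg (fun o => generator n (e o) ^ k (e o)) := by
  classical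
  have hpow : ∀ o, IsWeightedHomogeneous (gw n) (generator n (e o) ^ k (e o)) (k (e o) • 2) :=
    fun o => (isWeightedHomogeneous_generator (e o)).pow (k (e o))
  refine ⟨fun o => k (e o) • 2, fun o => X (e o) ^ k (e o), fun _ => 1, fun o μ hμ => ?_,
    fun o => ?_, ?_⟩
  · exact ((hpow o) (mem_support_iff.1 hμ)).symm.le
  · show weightedHomogeneousComponent (gw n) (k (e o) • 2) (generator n (e o) ^ k (e o)) =
      aeval (generator n) (X (e o) ^ k (e o))
    rw [map_pow (aeval (generator n)), aeval_X]
    exact weightedHomogeneousComponent_eq_self_of_isWeightedHomogeneous (hpow o)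
  · have hG : gradMatrix (fun _ => (1 : ℂ)) (fun o => X (e o) ^ k (e o)) =
        (Matrix.diagonal fun q : Fin n × Fin n => (k q : ℂ)).submatrix e (Equiv.refl _) := by
      ext o q
      simp only [gradMatrix, Matrix.of_apply, Matrix.submatrix_apply, Equiv.coe_refl, id,
        pderiv_pow, pderiv_X, map_mul, map_natCast, map_pow, eval_X, one_pow, mul_one]
      by_cases h : e o = q
      · subst h
        simp
      · have h' : ¬ q = e o := fun h'' => h h''.symm
        simp [Matrix.diagonal_apply_ne _ h, h']
    rw [hG, Matrix.rank_submatrix]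
    rw [Matrix.rank_of_isUnit _ ((Matrix.isUnit_iff_isUnit_det _).2 ?_), Fintype.card_prod,
      Fintype.card_fin]
    rw [Matrix.det_diagonal, isUnit_iff_ne_zero, Finset.prod_ne_zero_iff]
    exact fun q _ => Nat.cast_ne_zero.2 (hk q)

/-! ## Unmasking cost -/

namespace EqSystem

/-- **`E.UnmaskableAt U x` — unmaskable with `U` further products at the base point `x`.**
For EVERY nonscalar sequence `gs` carrying the tests of `E` cost-free (BCS §4.1: sums, scalars and
variables are free), there are at most `U` further nonscalar steps `hs` (each a product of two
cost-free combinations of what is already there) and a family `p`, cost-free over `hs ++ gs`, which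
after the free shift `θ_x` satisfies THEOREM D's hypotheses.  `U` counts the ELIMINATION PRODUCTS
(`ℓ · t_{o'}` with `ℓ` affine costs one); the minimal such `U` is the masking depth of `E` at `x`. -/
def UnmaskableAt (E : EqSystem n) (U : ℕ) (x : GraphVars n → ℂ) : Prop :=
  ∀ gs : List (MvPolynomial (GraphVars n) ℂ), IsNonscalarSeq gs →
    (∀ o : Fin E.tests.length, E.testPoly (E.tests.get o) ∈ freeSpan {q | q ∈ gs}) →
    ∃ (hs : List (MvPolynomial (GraphVars n) ℂ)) (T : ℕ) (p : Fin T → MvPolynomial (GraphVars n) ℂ),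
      IsNonscalarSeq (hs ++ gs) ∧ hs.length ≤ U ∧ (∀ o, p o ∈ freeSpan {q | q ∈ hs ++ gs}) ∧
      LowFormsNondeg (fun o => bind₁ (shift x) (p o))

/-- Monotone in the budget. -/
theorem UnmaskableAt.mono {E : EqSystem n} {U U' : ℕ} {x : GraphVars n → ℂ} (h : E.UnmaskableAt U x)
    (hU : U ≤ U') : E.UnmaskableAt U' x := by
  intro gs hgs hmem
  obtain ⟨hs, T, p, h1, h2, h3, h4⟩ := h gs hgs hmem
  exact ⟨hs, T, p, h1, h2.trans hU, h3, h4⟩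

/-- **Calibration 0**: a lowest-form nondegenerate system is unmaskable with NO further product
(take the tests themselves). -/
theorem unmaskableAt_zero_of_lowInitNondegAt {E : EqSystem n} {x : GraphVars n → ℂ}
    (h : E.LowInitNondegAt x) : E.UnmaskableAt 0 x := by
  intro gs hgs hmem
  obtain ⟨m, P, γ, hlow, hinit, hrank⟩ := h
  exact ⟨[], E.tests.length, fun o => E.testPoly (E.tests.get o), by simpa using hgs, le_rfl,
    by simpa using hmem, ⟨m, P, γ, hlow, hinit, hrank⟩⟩

end EqSystem

/-- **THEOREM D′ — THE BRIDGE IN MASKING CURRENCY.**  A fan-in-two system unmaskable with `U`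
further products at some base point gives `bR(⟨n,n,n⟩) ≤ 2·(cost + U)`: the multiplier of the
read-out is `1 + U/cost`, linear in the unmasking budget. -/
theorem algBorderRank_le_of_unmaskableAt {E : EqSystem n} (hE : E.circuit.IsFanInTwo) {U : ℕ}
    {x : GraphVars n → ℂ} (h : E.UnmaskableAt U x) :
    algBorderRank (matMulTensor ℂ n n n) ≤ 2 * (E.cost + U) := by
  obtain ⟨gs, hns, hlen, hmem⟩ := exists_isNonscalarSeq_tests E hE
  obtain ⟨hs, T, p, hseq, hU, hp, hlow⟩ := h gs hns hmem
  obtain ⟨hns', hmem'⟩ :=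
    IsNonscalarSeq.aeval_append (θ := shift x) (hs := []) (shift_mem_freeSpan x)
      isNonscalarSeq_nil hseq
  refine algBorderRank_le_of_lowFormsNondeg
    ⟨(hs ++ gs).map (aeval (shift x)) ++ [], hns', ?_, fun o => ?_⟩ hlow
  · simp only [List.append_nil, List.length_map, List.length_append]
    omega
  · rw [← aeval_eq_bind₁]
    exact hmem' _ (hp o)

/-- **INVERSION — cheap equations are deeply masked.**  If `2(cost + U) < bR(⟨n,n,n⟩)` then `E`
admits no unmasking with `U` products at any base point (on or off the graph). -/
theorem not_unmaskableAt_of_lt {E : EqSystem n} (hE : E.circuit.IsFanInTwo) {U : ℕ}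
    {x : GraphVars n → ℂ} (h : 2 * (E.cost + U) < algBorderRank (matMulTensor ℂ n n n)) :
    ¬ E.UnmaskableAt U x :=
  fun hU => lt_irrefl _ (lt_of_le_of_lt (algBorderRank_le_of_unmaskableAt hE hU) h)

/-! ## Calibration: generator systems (`U = 0`) and the masked family (`U ≤ 1`) -/

section Construction

variable (P : ArithCircuit ℂ (MatMulVars n)) (idx : Fin n × Fin n → ℕ)

/-- **Generator systems are unmasked** (`U = 0` at the origin).  For `n = 2` and `P` any circuit
with seven multiplications computing `AB` (Strassen [Strassen1969]) this is the cheapest correct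
system for `W_2` (census I68: every correct system has `≥ 7` products): the optimum at `n = 2` is
attained by a PURE family — Q3's first instance (critic g36 a2). -/
theorem generatorSystem_unmaskableAt_zero (hidx : ∀ p, idx p < P.size)
    (hval : ∀ p : Fin n × Fin n,
      (gateValues P.gates)[idx p]? = some (genericMatMulEntry ℂ n p.1 p.2)) :
    (generatorSystem P idx).UnmaskableAt 0 0 :=
  EqSystem.unmaskableAt_zero_of_lowInitNondegAt (generatorSystem_lowInitNondegAt_zero P idx hidx hval)

end Construction

/-- The generators other than `f₁₁` are among the masked tests. -/
theorem exists_maskedFamily_eq_generator (q : Fin 2 × Fin 2) (hq : q ≠ (1, 1)) :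
    ∃ i : Fin 4, maskedFamily i = generator 2 q := by
  obtain ⟨i, l⟩ := q
  fin_cases i <;> fin_cases l
  · exact ⟨0, rfl⟩
  · exact ⟨1, rfl⟩
  · exact ⟨2, rfl⟩
  · exact absurd rfl hq

/-- **Calibration 1 — the masked family is unmaskable with ONE product.**  Whatever nonscalar
sequence carries the masked tests `(f₀₀, f₀₁, f₁₀, t)`, the one further product `a₀₀·f₀₀` (both
factors cost-free: a variable and a test) and the free sum `t + a₀₀f₀₀ = f₁₁²` give the pure power
family `(f₀₀, f₀₁, f₁₀, f₁₁²)`, lowest-form nondegenerate at the origin.  (M31: the masked tests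
themselves are lowest-form degenerate at EVERY base point.) -/
theorem EqSystem.unmaskableAt_one_of_tests_eq_maskedFamily {E : EqSystem 2} (hlen : E.tests.length = 4)
    (hE : ∀ o : Fin E.tests.length, E.testPoly (E.tests.get o) = maskedFamily (Fin.cast hlen o)) :
    E.UnmaskableAt 1 0 := by
  classical
  intro gs hgs hmem
  have hin : ∀ i : Fin 4, maskedFamily i ∈ freeSpan {q | q ∈ gs} := fun i => by
    have h := hmem (Fin.cast hlen.symm i)
    rw [hE] at h
    simpa using h
  have hgen : ∀ q : Fin 2 × Fin 2, q ≠ (1, 1) → generator 2 q ∈ freeSpan {q | q ∈ gs} := by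
    intro q hq
    obtain ⟨i, hi⟩ := exists_maskedFamily_eq_generator q hq
    exact hi ▸ hin i
  -- the one elimination product
  set h₁ : MvPolynomial (GraphVars 2) ℂ := X a00 * generator 2 (0, 0) with hh₁
  -- the unmasked family, indexed through `e : Fin 4 ≃ Fin 2 × Fin 2`
  let e : Fin (2 * 2) ≃ Fin 2 × Fin 2 := finProdFinEquiv.symm
  let k : Fin 2 × Fin 2 → ℕ := fun q => if q = (1, 1) then 2 else 1
  have hsub : freeSpan {q | q ∈ gs} ≤ freeSpan {q | q ∈ [h₁] ++ gs} :=
    freeSpan_mono fun q hq => by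
      simp only [List.singleton_append, List.mem_cons, Set.mem_setOf_eq] at hq ⊢
      exact Or.inr hq
  refine ⟨[h₁], 2 * 2, fun o => generator 2 (e o) ^ k (e o), ?_, le_rfl, fun o => ?_, ?_⟩
  · exact isNonscalarSeq_cons.2 ⟨hgs, X a00, X_mem_freeSpan _ _, generator 2 (0, 0),
      hgen (0, 0) (by decide), hh₁⟩
  · show generator 2 (e o) ^ k (e o) ∈ _
    by_cases ho : e o = (1, 1)
    · have hk : k (e o) = 2 := by simp [k, ho]
      rw [hk, ho, ← maskedTest_add_unmask]
      refine add_mem (hsub ?_) (mem_freeSpan_of_mem (by simp [hh₁]))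
      exact hin 3
    · have hk : k (e o) = 1 := by simp [k, ho]
      rw [hk, pow_one]
      exact hsub (hgen _ ho)
  · simp only [bind₁_shift_zero]
    exact lowFormsNondeg_generator_pow e k fun q => by
      simp only [k]
      split_ifs <;> decide

/-! ## The dial in masking currency -/

/-- `EqAdmissibleUnmask β`: for all `n ≥ 1` there are correct systems `E` and budgets `U` with
`E` unmaskable with `U` products at some point and `cost E + U ≤ c·n^β`. -/
def EqAdmissibleUnmask (β : ℝ) : Prop :=
  ∃ c : ℝ, ∀ n : ℕ, 1 ≤ n → ∃ (E : EqSystem n) (U : ℕ) (x : GraphVars n → ℂ),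
    E.Correct ∧ E.UnmaskableAt U x ∧ ((E.cost + U : ℕ) : ℝ) ≤ c * (n : ℝ) ^ β

/-- **`EqAdmissibleUnmask β → ω ≤ β`** (THEOREM D′ + Bini). -/
theorem omega_le_of_eqAdmissibleUnmask {β : ℝ} (h : EqAdmissibleUnmask β) : omega ℂ ≤ β := by
  obtain ⟨c, hc⟩ := h
  refine omega_le_of_algBorderRank_bound (c := 2 * c) fun n hn => ?_
  obtain ⟨E, U, x, hE, hU, hcost⟩ := hc n hn
  have h1 : (algBorderRank (matMulTensor ℂ n n n) : ℝ) ≤ 2 * ((E.cost + U : ℕ) : ℝ) := by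
    exact_mod_cast algBorderRank_le_of_unmaskableAt hE.1 hU
  nlinarith [h1, hcost]

/-- Lowest-form admissibility is the case `U = 0`. -/
theorem eqAdmissibleUnmask_of_eqAdmissibleLowInit {β : ℝ} (h : EqAdmissibleLowInit β) :
    EqAdmissibleUnmask β := by
  obtain ⟨c, hc⟩ := h
  refine ⟨c, fun n hn => ?_⟩
  obtain ⟨E, hE, ⟨x, hx⟩, hcost⟩ := hc n hn
  exact ⟨E, 0, x, hE, EqSystem.unmaskableAt_zero_of_lowInitNondegAt hx, by simpa using hcost⟩

/-- `ω < β → EqAdmissibleUnmask β` (generator systems, `U = 0`). -/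
theorem eqAdmissibleUnmask_of_omega_lt {β : ℝ} (hβ : omega ℂ < β) : EqAdmissibleUnmask β :=
  eqAdmissibleUnmask_of_eqAdmissibleLowInit (eqAdmissibleLowInit_of_omega_lt hβ)

/-- **`H_unmask` — UNMASKING REDUCTION.**  A correct system of cost `O(n^β)` can be replaced, for
every `β' > β`, by correct systems unmaskable within total budget `cost + U = O(n^{β'})`: along
cost-optimal correct families the masking depth is `n^{o(1)} · cost`. -/
def UnmaskReduction : Prop :=
  ∀ β : ℝ, 2 ≤ β → EqAdmissible β → ∀ β' : ℝ, β < β' → EqAdmissibleUnmask β'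

/-- `H_init^♭ → H_unmask` (budget `0`). -/
theorem unmaskReduction_of_lowestFormReduction (h : LowestFormReduction) : UnmaskReduction :=
  fun β hβ hE β' hβ' => eqAdmissibleUnmask_of_eqAdmissibleLowInit (h β hβ hE β' hβ')

/-- **`H_unmask → H_mult`** (through `ω`: unmaskable families above `β` force `ω ≤ β`). -/
theorem multiplicityReduction_of_unmaskReduction (h : UnmaskReduction) : MultiplicityReduction := by
  intro β hβ hE β' hβ'
  obtain ⟨β₁, h₁, h₂⟩ := exists_between hβ'
  exact eqAdmissibleRed_of_omega_lt
    (lt_of_le_of_lt (omega_le_of_eqAdmissibleUnmask (h β hβ hE β₁ h₁)) h₂)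

/-- **`H_unmask ↔ H_mult`**: the attacked crux in masking currency (an equivalence THROUGH `ω`, as
M12 `H_mult ↔ Purification` and M29 `H_init^♭ ↔ H_mult`; recorded, not a new cut). -/
theorem unmaskReduction_iff_multiplicityReduction : UnmaskReduction ↔ MultiplicityReduction :=
  ⟨multiplicityReduction_of_unmaskReduction, fun h =>
    unmaskReduction_of_lowestFormReduction (lowestFormReduction_of_multiplicityReduction h)⟩

/-- **`ω = 2 → H_unmask`** (NEC). -/
theorem nec_unmaskReduction (h : _root_.MatrixMultiplication) : UnmaskReduction :=
  unmaskReduction_of_lowestFormReduction (nec_lowestFormReduction h)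

/-- `V ∧ H_unmask → ω = 2`. -/
theorem matrixMultiplication_of_quadratic_of_unmaskReduction (hV : GraphEquationsQuadratic)
    (hU : UnmaskReduction) : _root_.MatrixMultiplication :=
  matrixMultiplication_of_quadratic_of_lowestFormReduction hV
    (lowestFormReduction_of_multiplicityReduction (multiplicityReduction_of_unmaskReduction hU))

/-- **`ω = 2 ↔ V ∧ H_unmask`.** -/
theorem matrixMultiplication_iff_quadratic_unmaskReduction :
    _root_.MatrixMultiplication ↔ GraphEquationsQuadratic ∧ UnmaskReduction :=
  ⟨fun h => ⟨nec_quadratic h, nec_unmaskReduction h⟩,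
    fun h => matrixMultiplication_of_quadratic_of_unmaskReduction h.1 h.2⟩

end Summit.MatrixMultiplication.MatrixMultiplication.Theorems.GraphEquations
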